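import Literature.Claims.NS.LiuYong2026
import Literature.Analysis.FluidPDE.TorusNSSobolevControlLifespan
import Literature.Analysis.FluidPDE.TorusClassicalLerayHopfProofs
import Mathlib.Analysis.Calculus.BumpFunction.InnerProduct
import Mathlib.Analysis.Calculus.Deriv.Shift
import Mathlib.NumberTheory.Padics.PadicVal.Basic
import Mathlib.Data.Nat.Factorization.Basic
import HarnessLib

/-!
# C138 `LiuYong2026` (γ), part 1/2: the recurring 2-adic burst flow — an exact FORCED classical, hence global
# Leray–Hopf, Navier–Stokes solution on `[0,∞) × 𝕋³` inside the data class of Thm 1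

Records-grade companion RULED (γ) 2026-08-27T07:47:20Z to row #119 (token `Step3_K41`, p511629 untouched): the
witness for `not_Step3_K41_upper : ¬ Literature.Claims.NS.LiuYong2026.Step3_K41_upper` (part 2/2,
`SoloRefuteLiuYong2026K41Upper.lean`). Face `Step3_K41_upper` = rev 3 p512649 (ns-claims-typist-7 g5), printed locus
引理4.2 p.17 L4–p.18 L5 + 命题4.4 proof p.18 L22–L23 at the grain of 引理H.1 p.57 L13 (Zenodo 10.5281/zenodo.19681795).
THE FLOW. Time is cut into unit slots `[n, n+1)`; slot `n` carries the single real shear mode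
`Re(e₁ e^{2πi 2^m x₀})`, `m = v₂(n+1)` (so frequency `2^m e₀` recurs with density `2^{-(m+1)}`), with amplitude
`ψ(t − n)`, `ψ` a `C^∞` bump equal to 1 on `[7/16, 9/16]` and vanishing outside `(3/8, 5/8)`; at most one mode is
alive at any time and everything vanishes near slot boundaries, so the flow is locally a single modulated
eigenmode: `u = ψ(t−n)·w`, `p = 0`, `f = (ψ′ + 4π²ν4^m ψ)·w` solve the forced system EXACTLY (the shear mode is
divergence free, `Δw = −4π²4^m w`, `(w·∇)w = 0`). Datum `u(0) = 0`; force jointly smooth on `[0,∞) × 𝕋³`.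
Contents: the profile (§1), slots/modes/flows (§2), the modulated-eigenmode engine (§3; the `deriv`/`ContDiff ℝ ∞`
variant of ns-claims-refuter-5 g3's `isClassicalNSSolutionOn_modulated`, kit 79518d76a7dd02da / p511629, re-proved
here so that time-locality can be used off `[0,∞)`), locality (§4), and `isClassical_vel` / `isGlobalLerayHopf_vel` /
`isData_vel` (§5). Tree facts used: `Torus.IsClassicalNSSolutionOn.isLerayHopfOn_of_convex`, the single real Fourier
mode API (`realTrigPoly`, `isDivFree_realTrigPoly_singleton`, `laplacian_realTrigPoly_singleton`,
`Torus.convect_realTrigPoly_singleton_self_eq_zero`), `ContDiffBump`.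
Author: ns-claims-refuter-7 g3 ((γ) builder); adopter ns-claims-refuter-5 g3; filer ns-claims-salvage-p5 g3.
WHAT THIS IS NOT: not a claim about NS regularity or blow-up; not a claim about any author beyond the typed locator.
-/

noncomputable section
set_option linter.dupNamespace false

open Set MeasureTheory Filter Topology intervalIntegral UnitAddTorus Finset Metric
open scoped ContDiff BigOperators

namespace Summit.NavierStokesRegularity.NavierStokesRegularity.Theorems.LiuYong2026.K41Upper
open Literature.Claims.NS.LiuYong2026
open Literature.Analysis Literature.Analysis.FluidPDE Literature.Analysis.FunctionSpaces
open Literature.Analysis.FunctionSpaces.Torus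

/-! ## 1. The burst profile `ψ` -/
/-- Bump data on `ℝ`: centre `1/2`, inner radius `1/16`, outer radius `1/8`. -/
def bumpData : ContDiffBump (1 / 2 : ℝ) := ⟨1 / 16, 1 / 8, by norm_num, by norm_num⟩
/-- The burst profile `ψ`: smooth, `0 ≤ ψ ≤ 1`, `ψ = 1` on `[7/16, 9/16]`, `ψ = 0` off `(3/8, 5/8)`. -/
def ψ : ℝ → ℝ := bumpData
/-- `ψ` is smooth. -/
theorem ψ_contDiff : ContDiff ℝ ∞ ψ := bumpData.contDiff
/-- `0 ≤ ψ`. -/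
theorem ψ_nonneg (s : ℝ) : 0 ≤ ψ s := bumpData.nonneg
/-- `ψ ≤ 1`. -/
theorem ψ_le_one (s : ℝ) : ψ s ≤ 1 := bumpData.le_one
/-- `ψ(s) = 0` once `|s - 1/2| ≥ 1/8`. -/
theorem ψ_eq_zero {s : ℝ} (h : 1 / 8 ≤ |s - 1 / 2|) : ψ s = 0 :=
  bumpData.zero_of_le_dist (by rwa [Real.dist_eq])
/-- `ψ(s) = 1` once `|s - 1/2| ≤ 1/16`. -/
theorem ψ_eq_one {s : ℝ} (h : |s - 1 / 2| ≤ 1 / 16) : ψ s = 1 :=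
  bumpData.one_of_mem_closedBall (by rwa [mem_closedBall, Real.dist_eq])
/-- Off `[3/8, 5/8]` the profile vanishes identically near the point, so `ψ' = 0` there. -/
theorem deriv_ψ_eq_zero {s : ℝ} (h : 1 / 8 < |s - 1 / 2|) : deriv ψ s = 0 := by
  have ho : IsOpen {r : ℝ | 1 / 8 < |r - 1 / 2|} :=
    isOpen_lt continuous_const ((continuous_id.sub continuous_const).abs)
  have hev : ψ =ᶠ[𝓝 s] fun _ => (0 : ℝ) :=
    Filter.eventually_of_mem (ho.mem_nhds h) fun r hr => ψ_eq_zero (le_of_lt hr)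
  rw [hev.deriv_eq, deriv_const]

/-! ## 2. Slots, modes and the frozen single-mode flows -/
/-- The mode carried by the unit time slot `[n, n+1)`: the 2-adic valuation of `n + 1`
(so mode `m` recurs on the slots `n + 1 ∈ 2^m(2ℕ+1)`, an asymptotic fraction `2^{-(m+1)}` of time). -/
def slotMode (n : ℕ) : ℕ := padicValNat 2 (n + 1)
/-- Wave vector of mode `m`: `(2^m, 0, 0)`. -/
def kv (m : ℕ) : Z3 := Pi.single 0 (2 ^ m)
/-- Polarisation `e₁ ∈ ℂ³`, orthogonal to every `kv m`. -/
def pol : Z3 → C3 := fun _ => EuclideanSpace.single 1 1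
/-- The shear mode number `m`: `x ↦ Re (e_{kv m}(x) e₁)`. -/
def R (m : ℕ) : T3 → E3 := realTrigPoly {kv m} pol
/-- `(kv m)₀ = 2^m`. -/
theorem kv_apply_zero (m : ℕ) : kv m 0 = 2 ^ m := by simp [kv]
/-- `kv` is injective (first coordinates `2^m`). -/
theorem kv_injective : Function.Injective kv := fun a b h => by
  have h0 := congrFun h 0
  rw [kv_apply_zero, kv_apply_zero] at h0
  exact Nat.pow_right_injective le_rfl (by exact_mod_cast h0)
/-- `kv m ≠ -kv m'` (first coordinates `2^m > 0 > -2^{m'}`). -/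
theorem kv_ne_neg (m m' : ℕ) : kv m ≠ -kv m' := fun h => by
  have h0 := congrFun h 0
  rw [Pi.neg_apply, kv_apply_zero, kv_apply_zero] at h0
  have h1 : (0 : ℤ) < 2 ^ m := pow_pos two_pos m
  have h2 : (0 : ℤ) < 2 ^ m' := pow_pos two_pos m'
  omega
/-- `kv m ≠ 0`. -/
theorem kv_ne_zero (m : ℕ) : kv m ≠ 0 := fun h => by
  have h0 := congrFun h 0
  rw [kv_apply_zero, Pi.zero_apply] at h0
  exact pow_ne_zero m two_ne_zero h0
/-- `kv m · e₁ = 0`: the polarisation is transversal (divergence-free mode). -/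
theorem pol_orth (m : ℕ) : ∑ j, (kv m j : ℂ) * pol (kv m) j = 0 := by
  simp [kv, pol, Pi.single_apply]
/-- `|kv m|² = 4^m`. -/
theorem freqNormSq_kv (m : ℕ) : freqNormSq (kv m) = (2 ^ m) ^ 2 := by
  simp [freqNormSq, kv, Pi.single_apply]
/-- `klen (kv m) = 2^m`. -/
theorem klen_kv (m : ℕ) : klen (kv m) = 2 ^ m := by
  rw [klen, freqNormSq_kv, Real.sqrt_sq (by positivity)]
/-- `klen (-k) = klen k`. -/
theorem klen_neg (k : Z3) : klen (-k) = klen k := by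
  simp [klen, freqNormSq]
/-- Amplitude of slot `n`: `τ ↦ ψ(τ - n)`. -/
def amp (n : ℕ) (τ : ℝ) : ℝ := ψ (τ - n)
/-- Stokes eigenvalue constant `4π²|kv m|²`. -/
def lam (m : ℕ) : ℝ := 4 * Real.pi ^ 2 * freqNormSq (kv m)
/-- The frozen flow of slot `n`: the single shear mode `slotMode n` with amplitude `ψ(τ - n)`. -/
def U (n : ℕ) (τ : ℝ) (x : T3) : E3 := amp n τ • realTrigPoly {kv (slotMode n)} pol x
/-- The force of the frozen flow of slot `n`: `(ψ'(τ-n) + ν 4π²|k|² ψ(τ-n)) Re(e_k e₁)`. -/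
def F (ν : ℝ) (n : ℕ) (τ : ℝ) (x : T3) : E3 :=
  (deriv (amp n) τ + ν * (4 * Real.pi ^ 2 * freqNormSq (kv (slotMode n))) * amp n τ) •
    realTrigPoly {kv (slotMode n)} pol x
/-- **The witness velocity**: at time `t`, the frozen flow of the current slot `⌊t⌋₊`. -/
def vel (t : ℝ) : T3 → E3 := U ⌊t⌋₊ t
/-- **The witness force**: at time `t`, the force of the frozen flow of the current slot. -/
def frc (ν : ℝ) (t : ℝ) : T3 → E3 := F ν ⌊t⌋₊ t
/-- The amplitudes are smooth. -/
theorem amp_contDiff (n : ℕ) : ContDiff ℝ ∞ (amp n) :=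
  ψ_contDiff.comp (contDiff_id.sub contDiff_const)
/-- `(ψ(· - n))' (τ) = ψ'(τ - n)`. -/
theorem deriv_amp (n : ℕ) (τ : ℝ) : deriv (amp n) τ = deriv ψ (τ - n) :=
  deriv_comp_sub_const (f := ψ) (a := (n : ℝ)) (x := τ)
/-- `0 ≤ amp ≤ 1`. -/
theorem amp_sq_le_one (n : ℕ) (τ : ℝ) : amp n τ ^ 2 ≤ 1 := by
  have h0 := ψ_nonneg (τ - n)
  have h1 := ψ_le_one (τ - n)
  unfold amp
  nlinarith
/-- The amplitude of slot `n` vanishes once `|τ - n - 1/2| ≥ 1/8`. -/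
theorem amp_eq_zero {n : ℕ} {τ : ℝ} (h : 1 / 8 ≤ |τ - n - 1 / 2|) : amp n τ = 0 := ψ_eq_zero h
/-- Its derivative vanishes once `|τ - n - 1/2| > 1/8`. -/
theorem deriv_amp_eq_zero {n : ℕ} {τ : ℝ} (h : 1 / 8 < |τ - n - 1 / 2|) : deriv (amp n) τ = 0 := by
  rw [deriv_amp]; exact deriv_ψ_eq_zero h
/-- **Slot dichotomy.** Two times at distance `< 1/4` either lie in the same unit slot, or both
slots' amplitudes (and their derivatives) vanish at the second time. -/
theorem slot_dichotomy {t τ : ℝ} (h : |τ - t| < 1 / 4) :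
    ⌊τ⌋₊ = ⌊t⌋₊ ∨ (1 / 4 < |τ - ⌊τ⌋₊ - 1 / 2| ∧ 1 / 4 < |τ - ⌊t⌋₊ - 1 / 2|) := by
  by_cases hAB : ⌊τ⌋₊ = ⌊t⌋₊
  · exact Or.inl hAB
  right
  have ht1 : t < ⌊t⌋₊ + 1 := Nat.lt_floor_add_one t
  have hτ1 : τ < ⌊τ⌋₊ + 1 := Nat.lt_floor_add_one τ
  have hlt := (abs_lt.1 h)
  rcases Nat.lt_or_gt_of_ne hAB with hBA | hAB'
  · -- `⌊τ⌋₊ < ⌊t⌋₊`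
    have hc : (⌊τ⌋₊ : ℝ) + 1 ≤ ⌊t⌋₊ := by exact_mod_cast hBA
    have ht0 : 0 ≤ t := by
      by_contra hneg
      have : ⌊t⌋₊ = 0 := Nat.floor_eq_zero.2 (by linarith)
      omega
    have hA : (⌊t⌋₊ : ℝ) ≤ t := Nat.floor_le ht0
    constructor
    · exact lt_abs.2 (Or.inl (by linarith))
    · exact lt_abs.2 (Or.inr (by linarith))
  · -- `⌊t⌋₊ < ⌊τ⌋₊`
    have hc : (⌊t⌋₊ : ℝ) + 1 ≤ ⌊τ⌋₊ := by exact_mod_cast hAB'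
    have hτ0 : 0 ≤ τ := by
      by_contra hneg
      have : ⌊τ⌋₊ = 0 := Nat.floor_eq_zero.2 (by linarith)
      omega
    have hB : (⌊τ⌋₊ : ℝ) ≤ τ := Nat.floor_le hτ0
    constructor
    · exact lt_abs.2 (Or.inr (by linarith))
    · exact lt_abs.2 (Or.inl (by linarith))
/-- **Freezing of the velocity**: on the time window `|τ - t| < 1/4` the witness coincides with the
frozen flow of the slot of `t`. -/
theorem vel_frozen {t τ : ℝ} (h : |τ - t| < 1 / 4) : vel τ = U ⌊t⌋₊ τ := by
  rcases slot_dichotomy h with h0 | ⟨h1, h2⟩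
  · rw [vel, h0]
  · have e1 : amp ⌊τ⌋₊ τ = 0 := amp_eq_zero (by linarith)
    have e2 : amp ⌊t⌋₊ τ = 0 := amp_eq_zero (by linarith)
    funext x
    rw [vel, U, U, e1, e2, zero_smul, zero_smul]
/-- **Freezing of the force** on the same windows. -/
theorem frc_frozen (ν : ℝ) {t τ : ℝ} (h : |τ - t| < 1 / 4) : frc ν τ = F ν ⌊t⌋₊ τ := by
  rcases slot_dichotomy h with h0 | ⟨h1, h2⟩
  · rw [frc, h0]
  · have e1 : amp ⌊τ⌋₊ τ = 0 := amp_eq_zero (by linarith)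
    have e2 : amp ⌊t⌋₊ τ = 0 := amp_eq_zero (by linarith)
    have d1 : deriv (amp ⌊τ⌋₊) τ = 0 := deriv_amp_eq_zero (by linarith)
    have d2 : deriv (amp ⌊t⌋₊) τ = 0 := deriv_amp_eq_zero (by linarith)
    funext x
    rw [frc, F, F, e1, e2, d1, d2]
    simp
/-- `conj e₁ = e₁`. -/
theorem conjVec_pol (k : Z3) : EuclideanSpace.conjVec (pol k) = pol k := by
  ext i
  rw [EuclideanSpace.conjVec_apply]
  by_cases h : i = 1
  · subst h
    simp [pol]
  · simp [pol, h]
/-- `‖e₁‖ = 1`. -/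
theorem norm_pol (k : Z3) : ‖pol k‖ = 1 := by
  simp [pol]
/-- The slot indicator: `1` if `k = ± kv (slotMode n)`, else `0`. -/
def hit (k : Z3) (n : ℕ) : ℝ := if k = kv (slotMode n) ∨ k = -kv (slotMode n) then 1 else 0
/-- `0 ≤ hit ≤ 1`. -/
theorem hit_nonneg (k : Z3) (n : ℕ) : 0 ≤ hit k n := by
  unfold hit; split_ifs <;> norm_num
/-- `hit ≤ 1`. -/
theorem hit_le_one (k : Z3) (n : ℕ) : hit k n ≤ 1 := by
  unfold hit; split_ifs <;> norm_num

/-! ## 3. The frozen flows are exact forced classical solutions (engine of refuter-5 g3's kit, K6) -/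

section Modulated
variable {d : Type*} [Fintype d] [DecidableEq d]
/-- **A time-modulated eigenmode is an exact FORCED classical solution** (ns-claims-refuter-5 g3, C138 kit
`K6`, re-proved here): for a smooth divergence-free `w` with `Δw = −c w`, `(w·∇)w = ∇θ`, and a smooth
amplitude `a : ℝ → ℝ`, the triple `u = a(t) w`, `p = −a(t)² θ`, `f = (a′ + ν c a) w` solves the forced
Navier–Stokes system classically on `[0,∞)`. -/
theorem isClassicalNSSolutionOn_modulated_of_eigen {ν c : ℝ}
    {w : UnitAddTorus d → EuclideanSpace ℝ d} (hw : Torus.IsSmooth w) (hdiv : Torus.IsDivFree w)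
    (hlap : ∀ x, Torus.laplacian w x = -(c • w x))
    {θ : UnitAddTorus d → ℝ} (hθ : Torus.IsSmooth θ)
    (hconv : ∀ x, Torus.convect w w x = Torus.gradient θ x)
    {a : ℝ → ℝ} (ha : ContDiff ℝ ∞ a) :
    Torus.IsClassicalNSSolutionOn (Ici 0) ν (fun t x => (deriv a t + ν * c * a t) • w x)
      (fun t x => a t • w x) (fun t x => (-(a t ^ 2)) * θ x) where
  smooth_velocity :=
    (isSmoothSpaceTimeOn_of_time (θ := a) ha.contDiffOn).smul (isSmoothSpaceTimeOn_const hw _)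
  smooth_pressure :=
    (isSmoothSpaceTimeOn_of_time (θ := fun t : ℝ => -(a t ^ 2)) ((ha.pow 2).neg.contDiffOn)).mul
      (isSmoothSpaceTimeOn_const hθ _)
  momentum t ht x := by
    set e : ℝ := a t with he
    have hw1 : Torus.IsContDiff 1 w := hw.isContDiff (by simp)
    have hθ1 : Torus.IsContDiff 1 θ := hθ.isContDiff (by simp)
    have h1 : Torus.timeDerivWithin (Ici 0) (fun t x => a t • w x) t x = (deriv a t) • w x := by
      have hd : HasDerivAt (fun τ : ℝ => a τ • w x) ((deriv a t) • w x) t :=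
        ((ha.differentiable (by simp)).differentiableAt.hasDerivAt).smul_const (w x)
      exact hd.hasDerivWithinAt.derivWithin (uniqueDiffOn_Ici 0 t ht)
    have h2 : Torus.convect (fun x => e • w x) (fun x => e • w x) x =
        e • (e • Torus.gradient θ x) := by
      show Torus.fderiv (e • w) x ((e • w) x) = _
      rw [fderiv_const_smul hw1 e x, FunLike.coe_smul, Pi.smul_apply, Pi.smul_apply,
        map_smul, ← hconv x]
      rfl
    have h3 : Torus.laplacian (fun x => e • w x) x = e • (-(c • w x)) := by
      show Torus.laplacian (e • w) x = _
      rw [laplacian_const_smul_apply hw e x, hlap x]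
    have h4 : Torus.gradient (fun x => (-(e ^ 2)) * θ x) x = (-(e ^ 2)) • Torus.gradient θ x := by
      show Torus.gradient ((-(e ^ 2)) • θ) x = _
      exact Torus.gradient_const_smul hθ1 _ x
    rw [h1]
    show (deriv a t) • w x + Torus.convect (fun x => e • w x) (fun x => e • w x) x =
      ν • Torus.laplacian (fun x => e • w x) x - Torus.gradient (fun x => (-(e ^ 2)) * θ x) x +
        (deriv a t + ν * c * e) • w x
    rw [h2, h3, h4]
    module
  divFree t _ x := by
    show Torus.divergence (a t • w) x = 0
    exact Torus.isDivFree_const_smul (hw.isContDiff (by simp)) hdiv _ x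
/-- **Modulated single real shear mode** `u = a(t)·Re(e_k z)`, `k·z = 0` (refuter-5 g3, K6): an exact
classical solution on `[0,∞)` with zero pressure and force `(a′ + 4π²ν|k|² a)·Re(e_k z)`. -/
theorem isClassicalNSSolutionOn_modulated_singleton (ν : ℝ) {k₀ : d → ℤ}
    {c : (d → ℤ) → EuclideanSpace ℂ d} (hz : ∑ j, (k₀ j : ℂ) * c k₀ j = 0) {a : ℝ → ℝ}
    (ha : ContDiff ℝ ∞ a) :
    Torus.IsClassicalNSSolutionOn (Ici 0) ν
      (fun t x => (deriv a t + ν * (4 * Real.pi ^ 2 * freqNormSq k₀) * a t) • realTrigPoly {k₀} c x)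
      (fun t x => a t • realTrigPoly {k₀} c x) (fun _ _ => 0) := by
  have h := isClassicalNSSolutionOn_modulated_of_eigen (ν := ν)
    (c := 4 * Real.pi ^ 2 * freqNormSq k₀) (isSmooth_realTrigPoly {k₀} c)
    (isDivFree_realTrigPoly_singleton hz)
    (fun x => by rw [laplacian_realTrigPoly_singleton, neg_smul]) (isSmooth_const (0 : ℝ))
    (fun x => by
      rw [Torus.convect_realTrigPoly_singleton_self_eq_zero hz]
      unfold Torus.gradient liftAt
      simp [_root_.gradient]) ha
  have hp : (fun (t : ℝ) (_ : UnitAddTorus d) => (-(a t ^ 2)) * (0 : ℝ)) = fun _ _ => (0 : ℝ) := by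
    funext t x; ring
  rw [hp] at h
  exact h

end Modulated
/-- Each frozen flow `U n` is an exact forced classical solution on `[0,∞)` (zero pressure). -/
theorem isClassical_U (ν : ℝ) (n : ℕ) :
    Torus.IsClassicalNSSolutionOn (Ici 0) ν (F ν n) (U n) (fun _ _ => 0) :=
  isClassicalNSSolutionOn_modulated_singleton ν (pol_orth (slotMode n)) (amp_contDiff n)
/-- Each frozen force is jointly smooth (on any time set). -/
theorem isSmoothSpaceTimeOn_F (ν : ℝ) (n : ℕ) (S : Set ℝ) : IsSmoothSpaceTimeOn S (F ν n) := by
  have hθ : ContDiff ℝ ∞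
      (fun τ : ℝ => deriv (amp n) τ + ν * (4 * Real.pi ^ 2 * freqNormSq (kv (slotMode n))) * amp n τ) :=
    (contDiff_infty_iff_deriv.1 (amp_contDiff n)).2.add (contDiff_const.mul (amp_contDiff n))
  exact (isSmoothSpaceTimeOn_of_time hθ.contDiffOn).smul
    (isSmoothSpaceTimeOn_const (isSmooth_realTrigPoly _ _) S)

/-! ## 4. Locality: the witness is locally a frozen flow -/
/-- Joint smoothness is local in time: a field agreeing on every window `|τ - t| < 1/4` with a jointly
smooth field is jointly smooth. -/
theorem isSmoothSpaceTimeOn_of_frozen {S : Set ℝ} {v : ℝ → T3 → E3} {V : ℝ → ℝ → T3 → E3}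
    (hV : ∀ t, IsSmoothSpaceTimeOn S (V t)) (heq : ∀ t τ, |τ - t| < 1 / 4 → v τ = V t τ) :
    IsSmoothSpaceTimeOn S v := by
  intro p hp
  have ho : IsOpen {q : ℝ × EuclideanSpace ℝ (Fin 3) | |q.1 - p.1| < 1 / 4} :=
    isOpen_lt ((continuous_fst.sub continuous_const).abs) continuous_const
  have hmem : {q : ℝ × EuclideanSpace ℝ (Fin 3) | |q.1 - p.1| < 1 / 4} ∈ 𝓝[S ×ˢ univ] p :=
    mem_nhdsWithin_of_mem_nhds (ho.mem_nhds (by simp))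
  have hev : stLift v =ᶠ[𝓝[S ×ˢ univ] p] stLift (V p.1) :=
    Filter.eventually_of_mem hmem fun q hq => by
      show v q.1 (proj q.2) = V p.1 q.1 (proj q.2)
      rw [heq p.1 q.1 hq]
  exact (hV p.1 p hp).congr_of_eventuallyEq hev (by
    show v p.1 (proj p.2) = V p.1 p.1 (proj p.2)
    rw [heq p.1 p.1 (by simp)])
/-- Time derivatives are local: fields agreeing on the window `|τ - t| < 1/4` have the same one-sided
time derivative at `t`. -/
theorem timeDerivWithin_congr_frozen {S : Set ℝ} {v V : ℝ → T3 → E3} {t : ℝ}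
    (heq : ∀ τ, |τ - t| < 1 / 4 → v τ = V τ) (x : T3) :
    Torus.timeDerivWithin S v t x = Torus.timeDerivWithin S V t x := by
  unfold Torus.timeDerivWithin
  have hev : (fun τ => v τ x) =ᶠ[𝓝 t] fun τ => V τ x :=
    Filter.eventually_of_mem (Metric.ball_mem_nhds t (by norm_num : (0 : ℝ) < 1 / 4)) fun τ hτ => by
      rw [Metric.mem_ball, Real.dist_eq] at hτ
      show v τ x = V τ x
      rw [heq τ hτ]
  exact (hev.filter_mono nhdsWithin_le_nhds).derivWithin_eq (by
    show v t x = V t x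
    rw [heq t (by simp)])

/-! ## 5. The witness is an exact forced classical, hence global Leray–Hopf, solution -/
/-- **The burst flow is an exact forced classical Navier–Stokes solution on `[0,∞) × 𝕋³`** (zero pressure). -/
theorem isClassical_vel (ν : ℝ) :
    Torus.IsClassicalNSSolutionOn (Ici 0) ν (frc ν) vel (fun _ _ => 0) where
  smooth_velocity :=
    isSmoothSpaceTimeOn_of_frozen (fun t => (isClassical_U ν ⌊t⌋₊).smooth_velocity)
      (fun _ _ h => vel_frozen h)
  smooth_pressure := isSmoothSpaceTimeOn_const (isSmooth_const (0 : ℝ)) _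
  momentum t ht x := by
    rw [timeDerivWithin_congr_frozen (V := U ⌊t⌋₊) (fun τ h => vel_frozen h) x]
    exact (isClassical_U ν ⌊t⌋₊).momentum t ht x
  divFree t ht := (isClassical_U ν ⌊t⌋₊).divFree t ht
/-- **Global Leray–Hopf**: the burst flow is a global Leray–Hopf weak solution from its initial slice
(classical ⇒ Leray–Hopf on every `[0, T)`, `Torus.IsClassicalNSSolutionOn.isLerayHopfOn_of_convex`). -/
theorem isGlobalLerayHopf_vel (ν : ℝ) : Torus.IsGlobalLerayHopf ν (frc ν) (vel 0) vel :=
  fun _ hT => (isClassical_vel ν).isLerayHopfOn_of_convex (convex_Ici 0) hT Icc_subset_Ici_self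
/-- **Data class**: for `ν > 0` the force is jointly smooth on `[0,∞) × 𝕋³` and divergence free, the datum
(`= 0`, since `ψ(0) = 0`) smooth and divergence free — the data of Thm 1 / `IsData`. -/
theorem isData_vel {ν : ℝ} (hν : 0 < ν) : IsData ν (frc ν) (vel 0) where
  visc := hν
  force_smooth :=
    isSmoothSpaceTimeOn_of_frozen (fun t => isSmoothSpaceTimeOn_F ν ⌊t⌋₊ (Ici 0))
      (fun _ _ h => frc_frozen ν h)
  force_divFree _ _ :=
    Torus.isDivFree_const_smul ((isSmooth_realTrigPoly _ _).isContDiff (by simp))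
      (isDivFree_realTrigPoly_singleton (pol_orth _)) _
  datum_smooth := (isSmooth_realTrigPoly _ _).const_smul _
  datum_divFree :=
    Torus.isDivFree_const_smul ((isSmooth_realTrigPoly _ _).isContDiff (by simp))
      (isDivFree_realTrigPoly_singleton (pol_orth _)) _
/-- The datum is the rest state: `vel 0 = 0` (`ψ(0) = 0`). -/
theorem vel_zero : vel 0 = fun _ => 0 := by
  funext x
  have h : amp ⌊(0 : ℝ)⌋₊ 0 = 0 := amp_eq_zero (by norm_num [Nat.floor_zero])
  rw [vel, U, h, zero_smul]

end Summit.NavierStokesRegularity.NavierStokesRegularity.Theorems.LiuYong2026.K41Upper
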